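import Literature.NumberTheory.EllipticCurves.MazurTateFiniteLevelFunctionalEquationProofs
import Literature.NumberTheory.EllipticCurves.Sprung2017.SharpFlatPAdicLFunction
import HarnessLib

/-!
# Sprung 2017, Cor. 4.4 / Cor. 4.10 / Thm. 4.13: the functional equation of the combination
# `Y_n = u_n L♯ + v_n L♭` modulo `ω_n` (any `p`, `p`-integral symbols) — proofs only

A *proofs* companion (theorems only; no definition, no named fact) of `SharpFlatPAdicLFunction`
(`IsSprungPair`, `toIwasawa`, `sharpPoly`, `flatPoly`) and sequel of
`MazurTateFiniteLevelFunctionalEquationProofs` (the finite-level functional equation of the Mazur–Tate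
element, `exists_mazurTateElement_fe_integral`).

## Main results (in `Λ = ℤ_p⟦T⟧`, `ω_n = (1+T)^{pⁿ} − 1`, `ι = T^ι = (1+T)⁻¹ − 1`)

* `IsSprungPair.exists_add_eq_omega_mul` — for an INTEGRAL lift `Θ ∈ Λ` of `θ_n`, Sprung's congruence
  `θ_n ≡ −(u_n L♯ + v_n L♭) (mod ω_n)` (tree: `IsCongrModOmega`, a congruence in `Λ ⊗ ℚ_p` with a
  `p`-power multiplier) holds in `Λ` on the nose: `Θ + (u_n L♯ + v_n L♭) ∈ ω_n Λ` — by the descent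
  `p^m x ∈ ω_n Λ ⇒ x ∈ ω_n Λ` (`ω_n ≡ T^{pⁿ} (mod p)` and `𝔽_p⟦T⟧` is a domain).
* `IsSprungPair.exists_subst_sub_mul_eq_omega_mul` — **transport**: with `p`-integral plus symbols,
  Fricke sign `−σ` and `p`-adic exponent `c` of `⟨N⟩`, the combination `Y_n := u_n L♯ + v_n L♭` satisfies
  `Y_n(T^ι) − σ·(1+T)^c·Y_n(T) ∈ ω_n Λ` (`(1+T)^c = PowerSeries.binomialSeries ℤ_[p] c`; §1 proves
  `(1+T)^c ≡ (1+T)^{c mod pⁿ} (mod ω_n)` by Mahler continuity).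

This is the finite-level input of the functional equation of Sprung's TRACE COORDINATES `(L♯, L♭)·ℒ`
(`TraceCoordinateFunctionalEquationProofs`, `p = 3`, `a_3 = ±3`), whence both colours are non-zero on class
X8. HONEST FRAMING: elementary algebra in `Λ`; BSD is not proved by any of this.

## References

* F. Sprung, *On pairs of `p`-adic `L`-functions for weight-two modular forms*, Algebra & Number Theory 11
  (2017), Cor. 4.4–4.5 / Thm. 1.12 (the congruences `θ_n ≡ −(u_n L♯ + v_n L♭)`), Cor. 4.10 (integrality
  when `a_p ≢ 1 mod p`), Thm. 4.13 / Cor. 4.14 (functional equation). [Sprung2017]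
* B. Mazur, J. Tate, J. Teitelbaum, *On `p`-adic analogues of the conjectures of Birch and
  Swinnerton-Dyer*, Invent. Math. 84 (1986), §I.17 (functional equation). [MazurTateTeitelbaum1986Invent]
-/

noncomputable section

open scoped MatrixGroups ModularForm

open CongruenceSubgroup PowerSeries Literature.NumberTheory.EllipticCurves.ModularForms
  Literature.Barriers.BirchSwinnertonDyer

namespace Literature.NumberTheory.EllipticCurves.Sprung2017

/-! ## §1. Binomial series with `p`-adic exponents modulo `ω_n` -/

section Binomial

variable {p : ℕ} [Fact p.Prime]

-- adapted from Literature/Barriers/BirchSwinnertonDyer/PAdicFunctionalEquationSharpFlatTwoProofs.lean §1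
/-- `[T^e] G(ω) = Σ_{d ≤ e} [T^d]G · [T^e]ω^d` for `ω(0) = 0` (private plumbing). [folklore] -/
private theorem coeff_subst_eq_sum_range {R : Type*} [CommRing R] {ω : R⟦X⟧} (hω : constantCoeff ω = 0)
    (G : R⟦X⟧) (e : ℕ) :
    coeff e (G.subst ω) = ∑ d ∈ Finset.range (e + 1), coeff d G * coeff e (ω ^ d) := by
  rw [coeff_subst' (HasSubst.of_constantCoeff_zero' hω),
    finsum_eq_sum_of_support_subset _ (s := Finset.range (e + 1)) ?_]
  · simp only [smul_eq_mul]
  · intro d hd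
    simp only [Function.mem_support, ne_eq, Finset.coe_range, Set.mem_Iio] at hd ⊢
    by_contra hlt
    apply hd
    rw [coeff_of_lt_order e (lt_of_lt_of_le (by exact_mod_cast (by omega : e < d))
      (natCast_le_order_pow hω d)), smul_zero]

/-- `(1+T)^{k·y} = ((1+T)^k)^y` for `y ∈ ℤ_p`, `k ∈ ℕ` (Mahler continuity of `y ↦ (y choose d)` and
density of `ℕ` in `ℤ_p`); private plumbing. [folklore] -/
private theorem binomialSeries_natCast_mul_eq_subst (k : ℕ) (y : ℤ_[p]) :
    PowerSeries.binomialSeries ℤ_[p] ((k : ℤ_[p]) * y) =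
      (PowerSeries.binomialSeries ℤ_[p] y).subst ((1 + X : ℤ_[p]⟦X⟧) ^ k - 1) := by
  set ω : ℤ_[p]⟦X⟧ := (1 + X) ^ k - 1 with hωdef
  have hω : constantCoeff ω = 0 := by simp [hωdef]
  have hωs : HasSubst ω := HasSubst.of_constantCoeff_zero' hω
  ext e
  suffices h : (fun z : ℤ_[p] ↦ coeff e (PowerSeries.binomialSeries ℤ_[p] ((k : ℤ_[p]) * z))) =
      fun z ↦ coeff e ((PowerSeries.binomialSeries ℤ_[p] z).subst ω) from congrFun h y
  apply Continuous.ext_on PadicInt.denseRange_natCast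
  · simp only [binomialSeries_coeff, smul_eq_mul, mul_one]
    exact (PadicInt.continuous_choose e).comp (continuous_const.mul continuous_id)
  · have hform : (fun z : ℤ_[p] ↦ coeff e ((PowerSeries.binomialSeries ℤ_[p] z).subst ω)) =
        fun z ↦ ∑ d ∈ Finset.range (e + 1), Ring.choose z d * coeff e (ω ^ d) := by
      funext z
      rw [coeff_subst_eq_sum_range hω]
      simp only [binomialSeries_coeff, smul_eq_mul, mul_one]
    rw [hform]
    exact continuous_finsetSum _ fun d _ ↦ (PadicInt.continuous_choose d).mul continuous_const
  · rintro _ ⟨m, rfl⟩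
    have h1 : ((k : ℤ_[p]) * (m : ℤ_[p])) = ((k * m : ℕ) : ℤ_[p]) := by push_cast; ring
    have hone : (1 : ℤ_[p]⟦X⟧).subst ω = 1 := by
      rw [← coe_substAlgHom hωs, map_one]
    simp only
    rw [h1, binomialSeries_nat, binomialSeries_nat, subst_pow hωs, subst_add hωs, hone,
      subst_X hωs, pow_mul, hωdef, add_sub_cancel]

/-- `(1+T)^{pⁿy} ≡ 1 (mod ω_n)` in `Λ` for every `y ∈ ℤ_p`; private plumbing. [folklore] -/
private theorem exists_binomialSeries_pow_mul_sub_one_eq (n : ℕ) (y : ℤ_[p]) :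
    ∃ q : ℤ_[p]⟦X⟧, PowerSeries.binomialSeries ℤ_[p] (((p ^ n : ℕ) : ℤ_[p]) * y) - 1 =
      ((1 + X : ℤ_[p]⟦X⟧) ^ (p ^ n) - 1) * q := by
  set ω : ℤ_[p]⟦X⟧ := (1 + X) ^ (p ^ n) - 1 with hωdef
  have hω : constantCoeff ω = 0 := by simp [hωdef]
  have hωs : HasSubst ω := HasSubst.of_constantCoeff_zero' hω
  set G : ℤ_[p]⟦X⟧ := PowerSeries.binomialSeries ℤ_[p] y with hG
  have hG1 : constantCoeff G = 1 := binomialSeries_constantCoeff y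
  obtain ⟨H, hH⟩ : ∃ H : ℤ_[p]⟦X⟧, G - 1 = X * H := by
    refine ⟨PowerSeries.mk fun i ↦ coeff (i + 1) (G - 1), ?_⟩
    ext i
    rcases i with _ | i
    · simp [coeff_zero_eq_constantCoeff_apply, hG1]
    · rw [coeff_succ_X_mul, coeff_mk]
  refine ⟨H.subst ω, ?_⟩
  rw [binomialSeries_natCast_mul_eq_subst, ← hωdef, ← hG]
  have hGe : G = 1 + X * H := by rw [← hH]; ring
  have hone : (1 : ℤ_[p]⟦X⟧).subst ω = 1 := by rw [← coe_substAlgHom hωs, map_one]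
  conv_lhs => rw [hGe, subst_add hωs, hone, subst_mul hωs, subst_X hωs]
  ring

/-- **`(1+T)^c ≡ (1+T)^{c_n} (mod ω_n)`** in `Λ`, `c_n ∈ [0, pⁿ)` the residue of the `p`-adic exponent
`c` modulo `pⁿ`; private plumbing. [folklore] -/
private theorem exists_binomialSeries_sub_pow_val_eq (n : ℕ) (c : ℤ_[p]) :
    ∃ q : ℤ_[p]⟦X⟧, PowerSeries.binomialSeries ℤ_[p] c -
        (1 + X : ℤ_[p]⟦X⟧) ^ (PadicInt.toZModPow n c).val = ((1 + X : ℤ_[p]⟦X⟧) ^ (p ^ n) - 1) * q := by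
  haveI : NeZero (p ^ n) := ⟨pow_ne_zero _ (Fact.out : p.Prime).ne_zero⟩
  set m : ℕ := (PadicInt.toZModPow n c).val with hm
  have hx : PadicInt.toZModPow n c = (m : ZMod (p ^ n)) := by rw [hm, ZMod.natCast_zmod_val]
  have hker : c - (m : ℤ_[p]) ∈ RingHom.ker (PadicInt.toZModPow (p := p) n) := by
    rw [RingHom.mem_ker, map_sub, map_natCast, hx, sub_self]
  rw [PadicInt.ker_toZModPow, Ideal.mem_span_singleton] at hker
  obtain ⟨y, hy⟩ := hker
  obtain ⟨q, hq⟩ := exists_binomialSeries_pow_mul_sub_one_eq n y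
  refine ⟨(1 + X : ℤ_[p]⟦X⟧) ^ m * q, ?_⟩
  have hx' : c = (m : ℤ_[p]) + ((p ^ n : ℕ) : ℤ_[p]) * y := by
    push_cast; linear_combination hy
  rw [hx', binomialSeries_add, binomialSeries_nat]
  linear_combination ((1 + X : ℤ_[p]⟦X⟧) ^ m) * hq

end Binomial

/-! ## §2. Descent to `Λ`: the Sprung congruences hold integrally -/

section Descent

variable {p : ℕ} [Fact p.Prime]

/-- `ω_n ≡ T^{pⁿ} (mod p)`: if `p ∣ ω_n·q` in `Λ` then `p ∣ q` (`𝔽_p⟦T⟧` is a domain); private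
plumbing. [folklore] -/
private theorem C_dvd_of_C_dvd_omega_mul (n : ℕ) {q : ℤ_[p]⟦X⟧}
    (h : PowerSeries.C (p : ℤ_[p]) ∣ ((1 + X : ℤ_[p]⟦X⟧) ^ (p ^ n) - 1) * q) :
    PowerSeries.C (p : ℤ_[p]) ∣ q := by
  obtain ⟨r, hr⟩ := h
  -- reduce modulo `p`
  haveI : CharP (ZMod p)⟦X⟧ p :=
    charP_of_injective_algebraMap (R := ZMod p) (A := (ZMod p)⟦X⟧)
      (fun a b hab => by simpa using congrArg PowerSeries.constantCoeff hab) p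
  have hφp : PadicInt.toZMod (p : ℤ_[p]) = 0 := by rw [map_natCast, ZMod.natCast_self]
  have hmap := congrArg (PowerSeries.map (PadicInt.toZMod (p := p))) hr
  rw [map_mul, map_mul, PowerSeries.map_C, hφp, map_zero, zero_mul, map_sub, map_pow, map_add,
    map_one, PowerSeries.map_X, add_pow_char_pow, one_pow, add_sub_cancel_left] at hmap
  -- `X^{pⁿ} · q̄ = 0` in the domain `𝔽_p⟦T⟧`
  have hq0 : PowerSeries.map (PadicInt.toZMod (p := p)) q = 0 :=
    (mul_eq_zero.mp hmap).resolve_left (pow_ne_zero _ X_ne_zero)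
  -- lift coefficientwise
  have hcoef : ∀ i, ∃ t : ℤ_[p], coeff i q = (p : ℤ_[p]) * t := by
    intro i
    have hi : PadicInt.toZMod (coeff i q) = 0 := by
      have := congrArg (coeff i) hq0
      rwa [coeff_map, map_zero] at this
    have hmem : coeff i q ∈ RingHom.ker (PadicInt.toZMod (p := p)) := hi
    rw [PadicInt.ker_toZMod, PadicInt.maximalIdeal_eq_span_p, Ideal.mem_span_singleton'] at hmem
    obtain ⟨t, ht⟩ := hmem
    exact ⟨t, by rw [← ht, mul_comm]⟩
  choose t ht using hcoef
  refine ⟨PowerSeries.mk t, ?_⟩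
  ext i
  rw [coeff_C_mul, coeff_mk, ht]

/-- **Descent of `p`-power multiples through `ω_n`**: if `p^m · x = ω_n · q` in `Λ = ℤ_p⟦T⟧` then
`x ∈ ω_n Λ` (`ω_n ≡ T^{pⁿ} (mod p)` is a non-zero-divisor modulo `p`, and `Λ` is a domain).
[folklore] -/
private theorem exists_eq_omega_mul_of_C_pow_mul_eq (n m : ℕ) {x q : ℤ_[p]⟦X⟧}
    (h : PowerSeries.C ((p : ℤ_[p]) ^ m) * x = ((1 + X : ℤ_[p]⟦X⟧) ^ (p ^ n) - 1) * q) :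
    ∃ q' : ℤ_[p]⟦X⟧, x = ((1 + X : ℤ_[p]⟦X⟧) ^ (p ^ n) - 1) * q' := by
  induction m generalizing q with
  | zero => exact ⟨q, by simpa using h⟩
  | succ m ih =>
    rw [map_pow] at h
    have hdvd : PowerSeries.C (p : ℤ_[p]) ∣ ((1 + X : ℤ_[p]⟦X⟧) ^ (p ^ n) - 1) * q :=
      ⟨PowerSeries.C (p : ℤ_[p]) ^ m * x, by rw [← h]; ring⟩
    obtain ⟨q₁, hq₁⟩ := C_dvd_of_C_dvd_omega_mul n hdvd
    have hC : PowerSeries.C (p : ℤ_[p]) ≠ 0 := by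
      intro h0
      have h1 := congrArg PowerSeries.constantCoeff h0
      rw [constantCoeff_C, map_zero] at h1
      exact (Fact.out : p.Prime).ne_zero (by exact_mod_cast h1)
    refine ih (q := q₁) ?_
    apply mul_left_cancel₀ hC
    rw [map_pow]
    rw [hq₁] at h
    linear_combination h

/-- **Sprung's congruences hold in `Λ` on the nose for an integral Mazur–Tate element.** If
`(L♯, L♭)` is a Sprung pair for `f` at `p` (`θ_n ≡ −(u_n L♯ + v_n L♭) (mod ω_n)` in `Λ ⊗ ℚ_p`: the tree's
`IsCongrModOmega`, with its `p`-power multiplier) and `Θ ∈ Λ` is an integral lift of `θ_n`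
(`ι_Λ Θ = θ_n`; it exists when `a_p ≢ 1 (mod p)`, Cor. 4.10), then `Θ + (u_n L♯ + v_n L♭) ∈ ω_n Λ`.
[cite: Sprung2017, Cor. 4.10 with Cor. 4.4–4.5 / Thm. 1.12 (the congruences)] -/
theorem IsSprungPair.exists_add_eq_omega_mul {N : ℕ} {f : CuspForm (Gamma0 N) 2} {ap : ℤ}
    {Ls Lf : IwasawaAlgebra p} (h : IsSprungPair f p ap Ls Lf) (n : ℕ) {Θ : IwasawaAlgebra p}
    (hΘ : iwasawaToPowerSeries p Θ =
      (((mazurTateElement f p n).map (algebraMap ℚ ℚ_[p]) : Polynomial ℚ_[p]) : ℚ_[p]⟦X⟧)) :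
    ∃ q : IwasawaAlgebra p,
      Θ + (toIwasawa p (sharpPoly ap p n) * Ls + toIwasawa p (flatPoly ap p n) * Lf) =
        ((1 + X : ℤ_[p]⟦X⟧) ^ (p ^ n) - 1) * q := by
  obtain ⟨m, q, hmq⟩ := h n
  have hneg : (((-1 : Polynomial ℤ).map (Int.castRingHom ℤ_[p]) : Polynomial ℤ_[p]) : ℤ_[p]⟦X⟧) =
      -1 := by
    rw [Polynomial.map_neg, Polynomial.map_one, Polynomial.coe_neg, Polynomial.coe_one]
  rw [hneg, ← hΘ, coe_map_cyclotomicOmega] at hmq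
  have hΛ : PowerSeries.C ((p : ℤ_[p]) ^ m) *
      (Θ + (toIwasawa p (sharpPoly ap p n) * Ls + toIwasawa p (flatPoly ap p n) * Lf)) =
        ((1 + X : ℤ_[p]⟦X⟧) ^ (p ^ n) - 1) * q := by
    apply iwasawaToPowerSeries_injective p
    have e1 : iwasawaToPowerSeries p (PowerSeries.C ((p : ℤ_[p]) ^ m)) =
        PowerSeries.C ((p : ℚ_[p]) ^ m) := by
      rw [PowerSeries.map_C, map_pow, map_natCast]
    rw [map_mul, e1, ← hmq, map_add, map_mul (iwasawaToPowerSeries p) (-1), map_neg, map_one]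
    ring
  exact exists_eq_omega_mul_of_C_pow_mul_eq n m hΛ

end Descent

/-! ## §3. Transport: the functional equation of `Y_n = u_n L♯ + v_n L♭` modulo `ω_n` -/

section Transport

variable {N : ℕ} [NeZero N] {f : CuspForm (Gamma0 N) 2} {p : ℕ} [Fact p.Prime]

/-- **Transport of the finite-level functional equation to Sprung's combination (any `p`, integral
symbols).** Let `f ∈ S₂(Γ₀(N))` have `p`-integral plus symbols, `w_N f = −σ f` (`σ = ±1`), `c ∈ ℤ_p`
the exponent of `⟨N⟩` (`N = η_N γ^c`, i.e. `N ≡ η_N γ^{c mod pⁿ}` modulo `p^{n+e₀}` for all `n`), and let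
`(L♯, L♭)` be a Sprung pair for `f` at `p` with trace parameter `a_p`. Then for every `n` the combination
`Y_n := u_n L♯ + v_n L♭ ∈ Λ` (`u_n = sharpPoly`, `v_n = flatPoly`) satisfies
`Y_n(T^ι) − σ·(1+T)^c·Y_n(T) ∈ ω_n Λ`, `(1+T)^c = binomialSeries ℤ_p c`.
Proof: `Y_n = −Θ + ω_n q` integrally (`IsSprungPair.exists_add_eq_omega_mul`), the finite-level equation
`Θ(T^ι) − σ(1+T)^{c_n}Θ ∈ ω_nΛ` (`exists_mazurTateElement_fe_integral`), `ι(ω_n) = −E^{pⁿ}ω_n` and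
`(1+T)^c ≡ (1+T)^{c_n} (mod ω_n)`. This is Mazur–Tate–Teitelbaum §I.17 read on Sprung's Cor. 4.4
congruences — the finite-level shadow of the functional equation of the pair (Thm. 4.13 / Cor. 4.14).
[cite: Sprung2017, Thm. 4.13 and Cor. 4.14 (with Cor. 4.4, Cor. 4.10)]
[cite: MazurTateTeitelbaum1986Invent, §I.17] -/
theorem IsSprungPair.exists_subst_sub_mul_eq_omega_mul
    (hint : ∀ a k : ℕ, ‖((ratPlusSymbol f ((a : ℚ) / (p : ℚ) ^ k) : ℚ) : ℚ_[p])‖ ≤ 1)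
    {σ : ℤ} (hσ : σ ^ 2 = 1) (hW : IsFrickeEigen N f (-(σ : ℂ)))
    {ηN : rootsOfUnity (torsionOrder p) ℤ_[p]} {c : ℤ_[p]}
    (hc : ∀ n : ℕ, PadicInt.toZModPow (n + cyclotomicExponent p) ((ηN : ℤ_[p]ˣ) : ℤ_[p]) *
      (cyclotomicGenerator p : ZMod (p ^ (n + cyclotomicExponent p))) ^
        (PadicInt.toZModPow n c).val = (N : ZMod (p ^ (n + cyclotomicExponent p))))
    {ap : ℤ} {Ls Lf : IwasawaAlgebra p} (h : IsSprungPair f p ap Ls Lf) (n : ℕ) :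
    ∃ e : IwasawaAlgebra p,
      (toIwasawa p (sharpPoly ap p n) * Ls + toIwasawa p (flatPoly ap p n) * Lf).subst
          (invOnePlusSubOne : ℤ_[p]⟦X⟧) -
        (σ : IwasawaAlgebra p) * PowerSeries.binomialSeries ℤ_[p] c *
          (toIwasawa p (sharpPoly ap p n) * Ls + toIwasawa p (flatPoly ap p n) * Lf) =
      ((1 + X : ℤ_[p]⟦X⟧) ^ (p ^ n) - 1) * e := by
  have hιΛ := hasSubst_invOnePlusSubOne (R := ℤ_[p])
  obtain ⟨Θ, r, hΘ, hfe⟩ := exists_mazurTateElement_fe_integral hint hσ hW n (hc n)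
  obtain ⟨q, hq⟩ := h.exists_add_eq_omega_mul n hΘ
  obtain ⟨qD, hqD⟩ := exists_binomialSeries_sub_pow_val_eq n c
  rw [coe_map_cyclotomicOmega] at hfe
  -- `Y_n = −Θ + ω_n q`, substituted
  have hYsub : (toIwasawa p (sharpPoly ap p n) * Ls + toIwasawa p (flatPoly ap p n) * Lf).subst
      (invOnePlusSubOne : ℤ_[p]⟦X⟧) =
        -Θ.subst (invOnePlusSubOne : ℤ_[p]⟦X⟧) +
          (-((invOnePlusSubOne : ℤ_[p]⟦X⟧) + 1) ^ (p ^ n) * ((1 + X : ℤ_[p]⟦X⟧) ^ (p ^ n) - 1)) *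
            q.subst (invOnePlusSubOne : ℤ_[p]⟦X⟧) := by
    have hYe : toIwasawa p (sharpPoly ap p n) * Ls + toIwasawa p (flatPoly ap p n) * Lf =
        -Θ + ((1 + X : ℤ_[p]⟦X⟧) ^ (p ^ n) - 1) * q := by
      linear_combination hq
    rw [hYe, ← coe_substAlgHom hιΛ, map_add, map_neg, map_mul, coe_substAlgHom hιΛ,
      subst_invOnePlusSubOne_one_add_X_pow_sub_one]
  refine ⟨-r - ((invOnePlusSubOne : ℤ_[p]⟦X⟧) + 1) ^ (p ^ n) * q.subst (invOnePlusSubOne : ℤ_[p]⟦X⟧) +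
    (σ : IwasawaAlgebra p) * qD * Θ - (σ : IwasawaAlgebra p) * PowerSeries.binomialSeries ℤ_[p] c * q,
    ?_⟩
  rw [hYsub]
  linear_combination (-1 : ℤ_[p]⟦X⟧) * hfe -
    ((σ : IwasawaAlgebra p) * PowerSeries.binomialSeries ℤ_[p] c) * hq +
    ((σ : IwasawaAlgebra p) * Θ) * hqD

end Transport

end Literature.NumberTheory.EllipticCurves.Sprung2017

end
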